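import Literature.NumberTheory.Transcendental.CurvePeriodsEllipticLiftLinearityProofs
import Literature.NumberTheory.EllipticCurves.RealLatticeCovolumeProofs

/-!
# KontsevichZagierPeriods — kz1p class E1 derivations, part 2: real principal logarithms and their lattice relations

Cell pub-kz1p (KZ 1-periods), seat b2b-kz1p-2 (IMPLEMENTER), gen 13; helper of the rung-1 item
`stmt-KontsevichZagierPeriods-4990`, companion of `KzOnePeriodsE1DerivSpan.lean` (part 1).  Pure
mathematics over the tree's real-lattice theory (`PeriodPair.IsReal`, Lawden §§6.7, 6.11, 6.15) and its
uniformisation `φ = (℘, ℘′/2)` of `E_L : y² = x³ − (g₂/4)x − g₃/4`; no named facts, no `sorry`, no new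
definitions.

This is the NUMBER-LEVEL half of kz1p's connected E1 derivations.  The input of a case is an elliptic curve
`E : y² = x³ + ax + b` over `ℚ` (a real period pair `L` with `g₂ = −4a`, `g₃ = −4b`,
`exists_isReal_periodPair`) and rational points `X = (x, y)` on the identity component `E⁰(ℝ)` (`x > e₁`,
`e₁ = ℘(Ω₁/2)` the largest real root of `4x³ − g₂x − g₃ = 4(x³ + ax + b)`).  kz1p's elliptic logarithm
`u(X) = ∫_O^X dx/(2y)` is the PRINCIPAL real logarithm: the unique `u` with `φ(u) = X` in
`(0, Ω₁/2)` if `y < 0`, in `(−Ω₁/2, 0)` if `y > 0`, `u = Ω₁/2` if `y = 0` (`Ω₁ = L.minRealPeriod`, `℘`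
decreases from `+∞` to `e₁` on `(0, Ω₁/2]` with `℘′ < 0`, Lawden §6.11).  The file proves:

* existence of the principal logarithms (`exists_log_of_neg`, `exists_log_of_pos`, `phi_half_period`) from
  the certificate `x > e₁`, itself decided by `weierstrassPRe_half_eq_of_roots` (three rational roots:
  `e₁` is the largest) or `lt_half_of_discr_neg` (negative discriminant: `f(x) > 0` suffices, the lattice
  being rhombic so that `f < 0` left of `e₁`);
* the group law on logarithms as LATTICE RELATIONS decided without numerics: chord
  (`add_sub_mem_lattice_of_phi`), tangent (`two_mul_sub_mem_lattice_of_phi`), opposite points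
  (`add_mem_lattice_of_phi_neg`) — the side conditions are polynomial identities between the rational
  coordinates — and the integer in `Λ ∩ ℝ = ℤΩ₁` pinned by strict bounds (`eq_int_mul_of_mem`), which the
  case files obtain by `linarith` from the principal-value intervals (Σ|coefficients| ≤ 3 per step).

References: [HuberWustholz2022] §13.1 (pp. 119–121), §18.1 (pp. 160–161); [Lawden1989] D. F. Lawden,
*Elliptic Functions and Applications* (1989), §§6.7, 6.11, 6.15–6.16; [SilvermanAEC2009] III.2.3 (group law),
VI.5.1 (uniformisation); [CremonaAlgorithms1997] J. E. Cremona, *Algorithms for Modular Elliptic Curves*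
(2nd ed. 1997), §2.10 (real period lattices).
-/

noncomputable section

open Set Complex
open Literature.NumberTheory.Transcendental Literature.NumberTheory.Transcendental.CurvePeriods
open Literature.NumberTheory.Transcendental.CurvePeriods.Ell
open scoped PeriodPair

namespace Summit.KontsevichZagierPeriods.KzOnePeriods.E1RealLogs

variable {L : PeriodPair}

/-! ### Real period pairs with prescribed invariants -/

/-- **A real period pair with prescribed real invariants** `g₂ = A`, `g₃ = B` (`A³ ≠ 27B²`): existence by the
Uniformization Theorem, reality of the lattice by its uniqueness half.
[cite: SilvermanAEC2009, Thm VI.5.1] -/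
theorem exists_isReal_periodPair (A B : ℝ) (hD : A ^ 3 - 27 * B ^ 2 ≠ 0) :
    ∃ L : PeriodPair, L.IsReal ∧ L.g₂ = A ∧ L.g₃ = B := by
  obtain ⟨L, h2, h3⟩ := PeriodPair.uniformization_holds (A : ℂ) (B : ℂ) (by exact_mod_cast hD)
  exact ⟨L, PeriodPair.isReal_of_g₂_g₃_real PeriodPair.uniformization_unique_holds
    (by rw [h2, ofReal_im]) (by rw [h3, ofReal_im]), h2, h3⟩

/-! ### Rational literals -/

/-- A complex number equal to a rational cast is algebraic. [folklore] -/
theorem isAlgebraic_of_eq_ratCast {z : ℂ} (q : ℚ) (h : z = (q : ℂ)) : IsAlgebraic ℚ z := by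
  rw [h]; simpa using isAlgebraic_algebraMap (R := ℚ) (A := ℂ) q

/-- An algebraic point from its two coordinates. [folklore] -/
theorem isAlgPt_of_phi_eq₂ {u : ℂ} (hu : u ∉ L.lattice) {x y : ℂ} (hx : IsAlgebraic ℚ x)
    (hy : IsAlgebraic ℚ y) (h : phi L u = ![x, y]) : IsAlgPt L u :=
  isAlgPt_of_phi_eq L hu (p := ![x, y]) (fun k => by fin_cases k <;> simpa) h

/-! ### Real points off the lattice -/

section Real

/-- `u ∈ (0, Ω₁/2]` is not a lattice point. [folklore] -/
theorem notMem_of_pos (h : L.IsReal) {u : ℝ} (h0 : 0 < u) (h1 : u ≤ L.minRealPeriod / 2) :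
    (u : ℂ) ∉ L.lattice :=
  h.ofReal_notMem_lattice h0 (by linarith [h.minRealPeriod_pos])

/-- `u ∈ (−Ω₁/2, 0)` is not a lattice point. [folklore] -/
theorem notMem_of_neg (h : L.IsReal) {u : ℝ} (h0 : -(L.minRealPeriod / 2) < u) (h1 : u < 0) :
    (u : ℂ) ∉ L.lattice := by
  intro hu
  have h' : ((-u : ℝ) : ℂ) ∈ L.lattice := by push_cast; exact neg_mem hu
  exact h.ofReal_notMem_lattice (by linarith) (by linarith [h.minRealPeriod_pos]) h'

/-- `Ω₁ ∈ Λ`. [folklore] -/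
theorem minRealPeriod_mem (h : L.IsReal) : ((L.minRealPeriod : ℝ) : ℂ) ∈ L.lattice :=
  h.minRealPeriod_mem_lattice

/-! ### Principal logarithms on the identity component -/

/-- **Principal logarithm, lower half (`y < 0`)**: for `x > e₁` and `4y² = 4x³ − g₂x − g₃`, `y < 0`, there is
`u ∈ (0, Ω₁/2)` with `φ(u) = (x, y)` (`℘` maps `(0, Ω₁/2)` onto `(e₁, ∞)` and `℘′ < 0` there; Lawden §6.11).
[cite: Lawden1989, §6.11] -/
theorem exists_log_of_neg (h : L.IsReal) {x y : ℝ} (hx : L.weierstrassPRe (L.minRealPeriod / 2) < x)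
    (hxy : 4 * x ^ 3 - L.g₂.re * x - L.g₃.re = 4 * y ^ 2) (hy : y < 0) :
    ∃ u : ℝ, 0 < u ∧ u < L.minRealPeriod / 2 ∧ phi L u = ![(x : ℂ), (y : ℂ)] := by
  have hx' : x ∈ L.weierstrassPRe '' Ioo 0 (L.minRealPeriod / 2) := by
    rw [h.image_weierstrassPRe_Ioo]; exact hx
  obtain ⟨u, hu, hux⟩ := hx'
  have huΛ : (u : ℂ) ∉ L.lattice := notMem_of_pos h hu.1 hu.2.le
  have hsq := h.derivWeierstrassPRe_sq huΛ
  rw [hux, hxy] at hsq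
  have hneg := h.derivWeierstrassPRe_neg hu.1 hu.2
  have hq : L.derivWeierstrassPRe u = 2 * y := by
    have e : (L.derivWeierstrassPRe u - 2 * y) * (L.derivWeierstrassPRe u + 2 * y) = 0 := by
      linear_combination hsq
    rcases mul_eq_zero.1 e with e | e
    · linarith
    · linarith
  refine ⟨u, hu.1, hu.2, ?_⟩
  have e1 : ℘[L] u = (x : ℂ) := by rw [← h.ofReal_weierstrassPRe, hux]
  have e2 : ℘'[L] u = 2 * (y : ℂ) := by rw [← h.ofReal_derivWeierstrassPRe, hq]; push_cast; ring
  funext k; fin_cases k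
  · simp [e1]
  · simp [e2]

/-- **Principal logarithm, upper half (`y > 0`)**: `u ∈ (−Ω₁/2, 0)` with `φ(u) = (x, y)` (`φ(−u) = (x, −y)`).
[cite: Lawden1989, §6.11] -/
theorem exists_log_of_pos (h : L.IsReal) {x y : ℝ} (hx : L.weierstrassPRe (L.minRealPeriod / 2) < x)
    (hxy : 4 * x ^ 3 - L.g₂.re * x - L.g₃.re = 4 * y ^ 2) (hy : 0 < y) :
    ∃ u : ℝ, -(L.minRealPeriod / 2) < u ∧ u < 0 ∧ phi L u = ![(x : ℂ), (y : ℂ)] := by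
  obtain ⟨u, h0, h1, hu⟩ := exists_log_of_neg h hx (y := -y) (by rw [hxy]; ring) (by linarith)
  refine ⟨-u, by linarith, by linarith, ?_⟩
  have e1 : ℘[L] u = (x : ℂ) := by simpa using congrFun hu 0
  have e2 : ℘'[L] u / 2 = -(y : ℂ) := by simpa using congrFun hu 1
  rw [ofReal_neg, phi_neg, e1, e2, neg_neg]

/-- **The rational 2-torsion point of the identity component**: `φ(Ω₁/2) = (e₁, 0)`. [cite: Lawden1989, §6.7] -/
theorem phi_half_period (h : L.IsReal) :
    phi L ((L.minRealPeriod / 2 : ℝ) : ℂ) = ![(L.weierstrassPRe (L.minRealPeriod / 2) : ℂ), 0] := by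
  funext k; fin_cases k
  · simp [h.ofReal_weierstrassPRe]
  · show ℘'[L] ((L.minRealPeriod / 2 : ℝ) : ℂ) / 2 = 0
    rw [h.derivWeierstrassP_minRealPeriod_div_two, zero_div]

/-! ### Certificates for `x > e₁` -/

/-- **Three rational roots**: if `4x³ − g₂x − g₃ = 4(x − r₁)(x − r₂)(x − r₃)` with `r₃ < r₂ < r₁` then
`e₁ = ℘(Ω₁/2) = r₁` (`e₁` is a root, and `f > 0` on `(e₁, ∞)` while `f((r₁ + r₂)/2) < 0`).
[cite: Lawden1989, §6.11] -/
theorem weierstrassPRe_half_eq_of_roots (h : L.IsReal) {r₁ r₂ r₃ : ℝ} (h12 : r₂ < r₁)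
    (h23 : r₃ < r₂)
    (hf : ∀ x, 4 * x ^ 3 - L.g₂.re * x - L.g₃.re = 4 * (x - r₁) * (x - r₂) * (x - r₃)) :
    L.weierstrassPRe (L.minRealPeriod / 2) = r₁ := by
  set e := L.weierstrassPRe (L.minRealPeriod / 2) with he_def
  have he : 4 * (e - r₁) * (e - r₂) * (e - r₃) = 0 := by
    rw [← hf]; exact h.cubic_weierstrassPRe_half
  have hmid : 4 * ((r₁ + r₂) / 2) ^ 3 - L.g₂.re * ((r₁ + r₂) / 2) - L.g₃.re < 0 := by
    rw [hf]
    have ha : (r₁ + r₂) / 2 - r₁ < 0 := by linarith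
    have hb : 0 < (r₁ + r₂) / 2 - r₂ := by linarith
    have hc : 0 < (r₁ + r₂) / 2 - r₃ := by linarith
    have := mul_pos hb hc
    nlinarith
  by_contra hne
  have hlt : e < (r₁ + r₂) / 2 := by
    rcases mul_eq_zero.1 he with h1 | h1
    · rcases mul_eq_zero.1 h1 with h2 | h2
      · rcases mul_eq_zero.1 h2 with h3 | h3
        · norm_num at h3
        · exact absurd (sub_eq_zero.1 h3) hne
      · have : e = r₂ := sub_eq_zero.1 h2
        linarith
    · have : e = r₃ := sub_eq_zero.1 h1
      linarith
  linarith [h.cubic_pos_of_lt hlt]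

/-- **Negative discriminant**: if `g₂³ − 27g₃² < 0` (one real root; the lattice is rhombic,
`IsReal.discr_pos_of_half_sum_notMem`) then `f(x) = 4x³ − g₂x − g₃ > 0` already forces `x > e₁`: indeed
`℘(iΩ₁'/2) = ℘(−Ω₁/2) = e₁`, so `f < 0` on `(−∞, e₁)` (`IsReal.cubic_neg_of_lt`).
[cite: Lawden1989, §6.15–6.16] [cite: CremonaAlgorithms1997, §2.10 (p. 30)] -/
theorem lt_half_of_discr_neg (h : L.IsReal) (hdisc : L.g₂.re ^ 3 - 27 * L.g₃.re ^ 2 < 0) {x : ℝ}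
    (hx : 0 < 4 * x ^ 3 - L.g₂.re * x - L.g₃.re) : L.weierstrassPRe (L.minRealPeriod / 2) < x := by
  set Ω := L.minRealPeriod with hΩ_def
  set Ω' := (L.mulLeft I I_ne_zero).minRealPeriod with hΩ'_def
  have hcase : ((Ω : ℂ) + I * Ω') / 2 ∈ L.lattice := by
    by_contra hc
    have := h.discr_pos_of_half_sum_notMem hdisc.ne hc
    linarith
  have key : -(L.mulLeft I I_ne_zero).weierstrassPRe (Ω' / 2) = L.weierstrassPRe (Ω / 2) := by
    simp only [PeriodPair.weierstrassPRe]
    have e1 : ((Ω' / 2 : ℝ) : ℂ) = I * (-(I * ((Ω' / 2 : ℝ) : ℂ))) := by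
      rw [mul_neg, ← mul_assoc, I_mul_I]; ring
    rw [e1, PeriodPair.weierstrassP_mulLeft, PeriodPair.weierstrassP_neg, I_sq]
    have e2 : I * ((Ω' / 2 : ℝ) : ℂ) = -(((Ω / 2 : ℝ) : ℂ)) + ((Ω : ℂ) + I * Ω') / 2 := by
      push_cast; ring
    rw [e2, L.weierstrassP_add_coe _ ⟨_, hcase⟩, PeriodPair.weierstrassP_neg]
    norm_num
  by_contra hle
  push Not at hle
  rcases hle.eq_or_lt with heq | hlt
  · rw [heq] at hx
    linarith [h.cubic_weierstrassPRe_half]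
  · have := h.cubic_neg_of_lt (x := x) (by rw [key]; exact hlt)
    linarith

/-! ### Real lattice points: the integer pinned by bounds -/

/-- **`Λ ∩ ℝ = ℤΩ₁` with the integer decided by strict bounds**: a real lattice point `s` with
`(n − 1)Ω₁ < s < (n + 1)Ω₁` equals `nΩ₁`. [cite: Lawden1989, §6.15] -/
theorem eq_int_mul_of_mem (h : L.IsReal) {s : ℝ} (hs : (s : ℂ) ∈ L.lattice) (n : ℤ)
    (hlo : (n - 1) * L.minRealPeriod < s) (hhi : s < (n + 1) * L.minRealPeriod) :
    s = n * L.minRealPeriod := by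
  obtain ⟨k, hk⟩ := h.exists_eq_int_mul hs
  have hΩ := h.minRealPeriod_pos
  rw [hk] at hlo hhi
  have h1 : ((n : ℝ) - 1) < k := lt_of_mul_lt_mul_right hlo hΩ.le
  have h2 : (k : ℝ) < n + 1 := lt_of_mul_lt_mul_right hhi hΩ.le
  have h1' : n - 1 < k := by exact_mod_cast h1
  have h2' : k < n + 1 := by exact_mod_cast h2
  obtain rfl : k = n := by omega
  exact hk

end Real

/-! ### The group law as lattice relations among logarithms -/

/-- Coordinates from `φ(u) = (x, y)`: `℘(u) = x`, `℘′(u) = 2y`. [folklore] -/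
theorem wp_eq_of_phi {u x y : ℂ} (h : phi L u = ![x, y]) : ℘[L] u = x ∧ ℘'[L] u = 2 * y := by
  have e1 : ℘[L] u = x := by simpa using congrFun h 0
  have e2 : ℘'[L] u / 2 = y := by simpa using congrFun h 1
  exact ⟨e1, by rw [← e2]; ring⟩

/-- **Chord law**: if `φ(u) = (x₁, y₁)`, `φ(v) = (x₂, y₂)` with `x₁ ≠ x₂` and `φ(w)` is their chord sum
`(λ² − x₁ − x₂, λ(x₁ − x₃) − y₁)`, `λ = (y₁ − y₂)/(x₁ − x₂)`, then `u + v − w ∈ Λ` (addition theorems for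
`℘`, `℘′`; `φ` is injective modulo `Λ`). [cite: SilvermanAEC2009, III.2.3] -/
theorem add_sub_mem_lattice_of_phi {u v w : ℂ} (hu : u ∉ L.lattice) (hv : v ∉ L.lattice)
    (hw : w ∉ L.lattice) {x₁ y₁ x₂ y₂ x₃ y₃ : ℂ} (h1 : phi L u = ![x₁, y₁])
    (h2 : phi L v = ![x₂, y₂])
    (h3 : phi L w = ![x₃, y₃]) (hne : x₁ ≠ x₂)
    (hx : x₃ = ((y₁ - y₂) / (x₁ - x₂)) ^ 2 - x₁ - x₂)
    (hy : y₃ = (y₁ - y₂) / (x₁ - x₂) * (x₁ - x₃) - y₁) : u + v - w ∈ L.lattice := by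
  obtain ⟨eu, eu'⟩ := wp_eq_of_phi h1
  obtain ⟨ev, ev'⟩ := wp_eq_of_phi h2
  obtain ⟨ew, ew'⟩ := wp_eq_of_phi h3
  have hne' : ℘[L] u ≠ ℘[L] v := by rwa [eu, ev]
  have hd : x₁ - x₂ ≠ 0 := sub_ne_zero.2 hne
  have hX : ℘[L] (u + v) = x₃ := by
    rw [L.weierstrassP_add_holds u v hu hv hne', eu, ev, eu', ev', hx]
    field_simp
    ring
  have hY : ℘'[L] (u + v) = 2 * y₃ := by
    rw [PeriodPair.derivWeierstrassP_add_of_ne hu hv hne', hX, eu, ev, eu', ev', hy]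
    field_simp
    ring
  exact L.sub_mem_lattice_of_weierstrassP_eq
    (PeriodPair.add_notMem_lattice_of_weierstrassP_ne hne') hw (by rw [hX, ew]) (by rw [hY, ew'])

/-- **Tangent law**: if `φ(u) = (x₁, y₁)` with `y₁ ≠ 0` and `φ(w)` is the double
`(m² − 2x₁, m(x₁ − x₃) − y₁)`, `m = (3x₁² + A)/(2y₁)`, `A = −g₂/4`, then `2u − w ∈ Λ` (duplication
formulas for `℘`, `℘′`). [cite: SilvermanAEC2009, III.2.3 (d)] -/
theorem two_mul_sub_mem_lattice_of_phi {u w : ℂ} (hu : u ∉ L.lattice) (hw : w ∉ L.lattice)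
    {x₁ y₁ x₃ y₃ : ℂ} (h1 : phi L u = ![x₁, y₁]) (h3 : phi L w = ![x₃, y₃]) (hy : y₁ ≠ 0)
    (hx : x₃ = ((3 * x₁ ^ 2 + A L) / (2 * y₁)) ^ 2 - 2 * x₁)
    (hy3 : y₃ = (3 * x₁ ^ 2 + A L) / (2 * y₁) * (x₁ - x₃) - y₁) : 2 * u - w ∈ L.lattice := by
  obtain ⟨eu, eu'⟩ := wp_eq_of_phi h1
  obtain ⟨ew, ew'⟩ := wp_eq_of_phi h3
  have h0 : ℘'[L] u ≠ 0 := by rw [eu']; exact mul_ne_zero two_ne_zero hy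
  have hdd : deriv ℘'[L] u = 2 * (3 * x₁ ^ 2 + A L) := by
    rw [L.deriv_derivWeierstrassP hu, eu, A]; ring
  have hX : ℘[L] (2 * u) = x₃ := by
    rw [L.weierstrassP_two_mul_holds u hu h0, hdd, eu', eu, hx]
    field_simp
    ring
  have hY : ℘'[L] (2 * u) = 2 * y₃ := by
    rw [PeriodPair.derivWeierstrassP_two_mul_of_notMem hu (two_mul_notMem L h0), hX, hdd, eu', eu,
      hy3]
    field_simp
    ring
  exact L.sub_mem_lattice_of_weierstrassP_eq (two_mul_notMem L h0) hw
    (by rw [hX, ew]) (by rw [hY, ew'])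

/-- **Opposite points**: `φ(u) = (x, y)`, `φ(w) = (x, −y)` ⟹ `u + w ∈ Λ` (`φ(−w) = (x, y)`).
[cite: SilvermanAEC2009, III.2.3] -/
theorem add_mem_lattice_of_phi_neg {u w : ℂ} (hu : u ∉ L.lattice) (hw : w ∉ L.lattice) {x y : ℂ}
    (h1 : phi L u = ![x, y]) (h2 : phi L w = ![x, -y]) : u + w ∈ L.lattice := by
  obtain ⟨eu, eu'⟩ := wp_eq_of_phi h1
  obtain ⟨ew, ew'⟩ := wp_eq_of_phi h2
  have hw' : -w ∉ L.lattice := fun h' => hw (by simpa using neg_mem h')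
  have := L.sub_mem_lattice_of_weierstrassP_eq hu hw'
    (by rw [L.weierstrassP_neg, eu, ew]) (by rw [L.derivWeierstrassP_neg, eu', ew']; ring)
  simpa [sub_neg_eq_add] using this

end Summit.KontsevichZagierPeriods.KzOnePeriods.E1RealLogs

end
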